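/-
Copyright: the b2b-balaban T⁴-continuum CRUX team, row NE7b leaf lineage `t4-ne7b-formalise-leaf-06` (gen 157). Project licence.
-/
import Summits.QuantumFields.BalabanUV.T4Continuum.Spine.NE7b.HardStepMonotone
import Summits.QuantumFields.BalabanUV.T4Continuum.Spine.NE7b.ChartLetterTestSection

/-!
# THE NEXT STEP's THREE INPUT LETTERS ARE THE REFERENCE FLOW's, TIMES CONSTANTS THAT NEVER MOVE: under the sandwich
# `γ₀·P ≤ Q ≤ γ₁·P` the transported Hessian `Q⁺ = Q[T·,T·]` (critical section `T`) has kernel coercivity `γ₀·m_P`, size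
# `‖Q⁺‖ ≤ γ₁·C_P`, and an augmented-Hessian equivalence at the next blocking with
# `‖(T⁺)⁻¹‖ ≤ ‖H₂‖ + √(γ₁C₂∕(γ₀m_P)) + (γ₀m_P)⁻¹` — `m_P`, `C_P`, `C₂`, `H₂` being letters of the REFERENCE form's own hard steps
# (row NE7b, node U5c; assembly of this lineage's HSMO + CLTS + THEC BY NAME; [folklore])

Cell `pub-balaban`, sub-cell `t4`, spine estimate NE7b (`T4WeightBudget.RelWeightBound`; the cell's OWN estimate — NOT PRINTED in
[Bałaban 1983–89], NOT PROVED).  Crux-route work under `Spine/NE7b/` by a row leaf (`t4-ne7b-formalise-leaf-06` gen 157) in the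
hard-step cell under FREEZE (0)'s crux-prover clause; NOTHING of Bałaban's is named as a Lean object, valued or asserted; no
`T4Continuum/Support` leaf typed; no `def`; zero `sorry`.  ASSEMBLY ONLY, every step a sibling theorem BY NAME: this lineage's
`…HardStepMonotone` (HSMO: the sandwich passes through the hard step with the same constants; the next floor ∕ quadratic ceiling from the
reference's), `…ChartLetterTestSection` (CLTS: the augmented-Hessian equivalence constant through a test section), `…TransportedHessianEnergyCeiling`
(THEC: polarisation — a quadratic ceiling of a nonnegative symmetric form is an operator-norm ceiling).  Consumers BY SHAPE: leaf-06's
HSIS §3 `nextChart_of_letters` ∕ `inductiveStep` (their scale-`k+1` inputs `hco`, `hN`, `‖Q⁺‖ ≤ β` are the three conclusions below), the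
OWNER's `…FreeFieldBlockingLetters` (the reference flow's `m_P`, `C_P`, `‖H‖` BY VALUE on `ℤ^d`, k-uniform, d-only constants — the supplier
of this file's displayed reference letters on the Gaussian skeleton).

WHY.  The pricing desk's word on HSMO ([NE7bREF-G99-WORD-HSMO]): with the reference `P_k` := the free flow and a fine-level sandwich, «the
level-k kernel floor ∕ size ceiling ∕ CLTS chart letter through the reference section `H_k` are the reference flow's letters × `γ₀` ∕ `γ₁` ∕
`√(γ₁∕γ₀)`: `m_{Q,k} ≥ γ₀·m_{P,k}`, `C_{Q,k} ≤ γ₁·C_{P,k}`, `N_k ≤ ‖H_k‖ + √(γ₁C_{P,k}∕(γ₀m_{P,k})) + (γ₀m_{P,k})⁻¹` — k-UNIFORM because the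
free flow converges to its fixed point».  This file is that sentence as one theorem per letter and one conjunction, so that HSIS's next
step STARTS from reference letters with no hypothesis hidden: the only inputs about the interacting form are the sandwich and the
criticality of its section; everything by value is a letter of the reference form's own hard steps (`P⁺ = P[H·,H·]`, its floor on
`ker D₂`, its diagonal through the next reference section `H₂`).

WHAT IS PROVED ([folklore] assembly; `E`, `F` real inner-product spaces (`F` complete in §2), `G` real normed; `Q P : E →L E →L ℝ`
symmetric and `≥ 0` on `E`; `D : E →L F`; `T` the `Q`-critical and `H` the `P`-critical section of `D`; `0 < γ₀`, `γ₀·P ≤ Q ≤ γ₁·P` on `E`;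
`Q⁺ := Q.bilinearComp T T`, `P⁺ := P.bilinearComp H H`; next blocking `D₂ : F →L G`):
* §1 **`nextFloor_of_sandwich`** (`P⁺` `m_P`-coercive on `ker D₂` ⟹ `Q⁺` `(γ₀m_P)`-coercive — HSMO BY NAME, restated here only as the
  conjunction's first component), **`nextSize_of_sandwich`** (`P⁺ k k ≤ C_P‖k‖²`, `0 ≤ γ₁`, `0 ≤ C_P` ⟹ `‖Q⁺‖ ≤ γ₁·C_P` — HSMO's quadratic
  ceiling + THEC `opNorm_le_of_abs_quad_le`), `nextEnergy_of_sandwich` (the next TEST-SECTION energy: for ANY section `H₂` of `D₂`,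
  `Q⁺(H₂g)(H₂g) ≤ γ₁·P⁺(H₂g)(H₂g)`, so a reference letter `P⁺(H₂g)(H₂g) ≤ C₂‖g‖²` gives `Q⁺(H₂g)(H₂g) ≤ (γ₁C₂)‖g‖²`).
* §2 **`nextChart_of_sandwich`** (`F` complete; `H₂` ANY section of `D₂` with the reference letter `P⁺(H₂g)(H₂g) ≤ C₂‖g‖²`, `0 < m_P`,
  `0 ≤ C₂`, `0 ≤ γ₁` ⟹ `∃ T⁺ : F ≃L G × (ker D₂ →L ℝ)` reading `(D₂, Q⁺)` with `‖(T⁺)⁻¹ y‖ ≤ (‖H₂‖ + √(γ₁C₂∕(γ₀m_P)) + (γ₀m_P)⁻¹)‖y‖` —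
  CLTS `exists_augHessian_equiv_of_testSection` at `(Q⁺, D₂, S := H₂)`), `nextChart_of_sandwich_nnreal` (any `N : ℝ≥0` above the constant —
  HSCR ∕ HSIS's `hN` at scale `k+1` VERBATIM).
* §3 **`nextLetters_of_sandwich`** — THE CONJUNCTION: floor `γ₀m_P`, size `γ₁C_P`, chart `T⁺` with the constant above — HSIS §3
  `nextChart_of_letters`' three inputs, every number the reference's.
* §4 **`nextLetters_energyCurrency`** — IN THE REFERENCE's ENERGY CURRENCY (`E`'s inner product IS `P`; `F`, `G` carry the quotient norms:
  the orthogonal sections `H`, `H₂` are isometries) the three letters ARE the sandwich constants: `Q⁺` `γ₀`-coercive on all of `F`,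
  `Q⁺ ≤ γ₁‖·‖²`, `‖Q⁺‖ ≤ γ₁`, and `‖(T⁺)⁻¹‖ ≤ 1 + √(γ₁∕γ₀) + γ₀⁻¹` — `k`-free, `L`-free, `d`-free; the sandwich is inherited in this
  currency, so the region `{γ₀ ≤ Q ≤ γ₁}` is invariant along the tower (the pricing desk's (d2) «`N_k` k-uniform» at the letter level).
  LOCATED BY THE DESK ([NE7bREF-G99-WORD-HSRF], zero weight here): (i) in the energy currency there is NO rescaling gain per step, so the
  PER-STEP radius recursion `r_{k+1} = (N♭⁻¹ − c_k)·r_k` still contracts — §4's letters serve the radius ONE-SHOT (leaf-03's HSGT §5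
  `tower_branch_eq_oneShot`: one factor for the composite blocking, k-uniform with the constant `N♭ = 1 + √(γ₁∕γ₀) + γ₀⁻¹`); (ii) the
  energy ball is EXTENSIVE while print's small-field regions are INTENSIVE — the by-value debt of (d2) moves into that currency junction
  ((A3)'s neighbourhood; NOT typed here).
* §5 toy.

NOT HERE (honest): the reference letters BY VALUE (the OWNER's `FreeFieldBlockingLetters` on `ℤ^d`; the desk's instruments); the
fine-level sandwich on the window ((d1): (A3) ∕ (A1c), NC-NE7b-α UNRULED); the chart RADIUS recursion and the moduli ((d2): HSCR ∕ HSIS's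
`r⁺ = (N⁻¹ − c)·r`, `M₃`); anything of Bałaban's.  BY-NAME EFFECT ON THE WALL: NONE.  NE7b NOT PRINTED ∕ NOT PROVED; spine PROVED 0∕9;
rung (B)+1 on a FINITE torus — NOT infinite volume, NOT the mass gap, NOT Clay.  HONEST DEPENDENCY: continuum YM on T⁴ ⇐ BetaPertH ∧ nine
spine estimates (0∕9 proved); BetaPertH ⇐ (D1) ∧ (D4) ∧ CAP+tail; G-an2-4 gates asym, D1 and NE2∕3∕4.
-/

set_option autoImplicit false

noncomputable section

namespace Summit.QuantumFields.BalabanUV.T4Continuum.NE7b.HardStepReferenceLetters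

open scoped NNReal
open Summit.QuantumFields.BalabanUV.T4Continuum.NE7b

variable {E F G : Type*} [NormedAddCommGroup E] [InnerProductSpace ℝ E] [NormedAddCommGroup F] [InnerProductSpace ℝ F]
  [NormedAddCommGroup G] [NormedSpace ℝ G]

/-! ## §1. Floor, size and test-section energy of the next form from the reference's -/

/-- **THE NEXT FLOOR** (HSMO `kerCoercive_of_dominates_reference`, as the conjunction's first letter): `P⁺` `m_P`-coercive on `ker D₂`
⟹ `Q⁺` `(γ₀m_P)`-coercive on `ker D₂`. [folklore] -/
theorem nextFloor_of_sandwich (Q P : E →L[ℝ] E →L[ℝ] ℝ) (D : E →L[ℝ] F) (T H : F →L[ℝ] E)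
    (hT : ∀ k, D (T k) = k) (hH : ∀ k, D (H k) = k) (hHorth : ∀ k κ, D κ = 0 → P (H k) κ = 0)
    (hPsymm : ∀ u v, P u v = P v u) (hP0 : ∀ v, 0 ≤ P v v) {γ₀ : ℝ} (hγ₀ : 0 ≤ γ₀) (hlo : ∀ v, γ₀ * P v v ≤ Q v v)
    (D₂ : F →L[ℝ] G) {mP : ℝ} (hcoP : ∀ k, D₂ k = 0 → mP * ‖k‖ ^ 2 ≤ (P.bilinearComp H H) k k) :
    ∀ k, D₂ k = 0 → γ₀ * mP * ‖k‖ ^ 2 ≤ (Q.bilinearComp T T) k k :=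
  HardStepMonotone.kerCoercive_of_dominates_reference Q P D T H hT hH hHorth hPsymm (fun κ _ => hP0 κ) hγ₀ hlo D₂ hcoP

omit [NormedAddCommGroup G] [NormedSpace ℝ G] in
/-- **THE NEXT SIZE**: `Q` symmetric with `T` its critical section, `Q ≥ 0` and `P ≥ 0` on `E`, `0 ≤ γ₀`, `γ₀·P ≤ Q ≤ γ₁·P`, a quadratic
ceiling `P⁺ k k ≤ C_P‖k‖²` of the reference's hard step (`0 ≤ γ₁`, `0 ≤ C_P`) ⟹ `‖Q⁺‖ ≤ γ₁·C_P` (HSMO's ceiling + THEC's polarisation, `F`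
an inner-product space). [folklore] -/
theorem nextSize_of_sandwich (Q P : E →L[ℝ] E →L[ℝ] ℝ) (D : E →L[ℝ] F) (T H : F →L[ℝ] E)
    (hT : ∀ k, D (T k) = k) (hH : ∀ k, D (H k) = k) (hTorth : ∀ k κ, D κ = 0 → Q (T k) κ = 0)
    (hQsymm : ∀ u v, Q u v = Q v u) (hQ0 : ∀ v, 0 ≤ Q v v) (hP0 : ∀ v, 0 ≤ P v v)
    {γ₀ γ₁ : ℝ} (hγ₀ : 0 ≤ γ₀) (hγ₁ : 0 ≤ γ₁) (hlo : ∀ v, γ₀ * P v v ≤ Q v v) (hhi : ∀ v, Q v v ≤ γ₁ * P v v)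
    {CP : ℝ} (hCP0 : 0 ≤ CP) (hCP : ∀ k, (P.bilinearComp H H) k k ≤ CP * ‖k‖ ^ 2) :
    ‖Q.bilinearComp T T‖ ≤ γ₁ * CP := by
  refine TransportedHessianEnergyCeiling.opNorm_le_of_abs_quad_le _ (HardStepMonotone.bilinearComp_symm Q T hQsymm)
    (mul_nonneg hγ₁ hCP0) fun k => ?_
  rw [abs_of_nonneg (HardStepMonotone.transported_nonneg_of_dominates Q P T hγ₀ hlo hP0 k)]
  exact HardStepMonotone.quad_le_of_dominated_reference Q P D T H hT hH hTorth hQsymm (fun κ _ => hQ0 κ) hγ₁ hhi hCP k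

omit [NormedSpace ℝ G] in
/-- **THE NEXT TEST-SECTION ENERGY**: for ANY map `H₂ : G → F` and a reference letter `P⁺(H₂g)(H₂g) ≤ C₂‖g‖²` (`0 ≤ γ₁`),
`Q⁺(H₂g)(H₂g) ≤ (γ₁C₂)‖g‖²` — the energy letter CLTS ∕ THEC ask of a test section at the next scale. [folklore] -/
theorem nextEnergy_of_sandwich (Q P : E →L[ℝ] E →L[ℝ] ℝ) (D : E →L[ℝ] F) (T H : F →L[ℝ] E)
    (hT : ∀ k, D (T k) = k) (hH : ∀ k, D (H k) = k) (hTorth : ∀ k κ, D κ = 0 → Q (T k) κ = 0)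
    (hQsymm : ∀ u v, Q u v = Q v u) (hQ0 : ∀ v, 0 ≤ Q v v) {γ₁ : ℝ} (hγ₁ : 0 ≤ γ₁) (hhi : ∀ v, Q v v ≤ γ₁ * P v v)
    (H₂ : G → F) {C₂ : ℝ} (hC₂ : ∀ g, (P.bilinearComp H H) (H₂ g) (H₂ g) ≤ C₂ * ‖g‖ ^ 2) (g : G) :
    (Q.bilinearComp T T) (H₂ g) (H₂ g) ≤ γ₁ * C₂ * ‖g‖ ^ 2 :=
  calc (Q.bilinearComp T T) (H₂ g) (H₂ g) ≤ γ₁ * (P.bilinearComp H H) (H₂ g) (H₂ g) :=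
        HardStepMonotone.transported_le_of_dominated Q P D T H hT hH hTorth hQsymm (fun κ _ => hQ0 κ) hhi (H₂ g)
    _ ≤ γ₁ * (C₂ * ‖g‖ ^ 2) := mul_le_mul_of_nonneg_left (hC₂ g) hγ₁
    _ = γ₁ * C₂ * ‖g‖ ^ 2 := by ring

/-! ## §2. The next chart's equivalence constant from the reference's next section -/

/-- **THE NEXT CHART CONSTANT FROM THE REFERENCE FLOW.**  `F` a real Hilbert space; the sandwich data of §1 with `0 < γ₀`; at the
next blocking `D₂`: the reference's floor `P⁺` `m_P`-coercive on `ker D₂` (`0 < m_P`) and, for ANY section `H₂` of `D₂`, the reference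
letter `P⁺(H₂g)(H₂g) ≤ C₂‖g‖²` (`0 ≤ C₂`) ⟹ `∃ T⁺ : F ≃L G × (ker D₂ →L ℝ)` reading `(D₂, Q⁺)` with
`‖(T⁺)⁻¹ y‖ ≤ (‖H₂‖ + √(γ₁C₂∕(γ₀m_P)) + (γ₀m_P)⁻¹)‖y‖` — CLTS at `(Q⁺, D₂, S := H₂)` with §1's floor and energy. [folklore] -/
theorem nextChart_of_sandwich [CompleteSpace F] (Q P : E →L[ℝ] E →L[ℝ] ℝ) (D : E →L[ℝ] F) (T H : F →L[ℝ] E)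
    (hT : ∀ k, D (T k) = k) (hH : ∀ k, D (H k) = k) (hTorth : ∀ k κ, D κ = 0 → Q (T k) κ = 0)
    (hHorth : ∀ k κ, D κ = 0 → P (H k) κ = 0) (hQsymm : ∀ u v, Q u v = Q v u) (hPsymm : ∀ u v, P u v = P v u)
    (hQ0 : ∀ v, 0 ≤ Q v v) (hP0 : ∀ v, 0 ≤ P v v)
    {γ₀ γ₁ : ℝ} (hγ₀ : 0 < γ₀) (hγ₁ : 0 ≤ γ₁) (hlo : ∀ v, γ₀ * P v v ≤ Q v v) (hhi : ∀ v, Q v v ≤ γ₁ * P v v)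
    (D₂ : F →L[ℝ] G) (H₂ : G →L[ℝ] F) (hH₂ : ∀ g, D₂ (H₂ g) = g)
    {mP : ℝ} (hmP : 0 < mP) (hcoP : ∀ k, D₂ k = 0 → mP * ‖k‖ ^ 2 ≤ (P.bilinearComp H H) k k)
    {C₂ : ℝ} (hC₂0 : 0 ≤ C₂) (hC₂ : ∀ g, (P.bilinearComp H H) (H₂ g) (H₂ g) ≤ C₂ * ‖g‖ ^ 2) :
    ∃ Tn : F ≃L[ℝ] G × (D₂.ker →L[ℝ] ℝ),
      (∀ h, Tn h = (D₂ h, ((Q.bilinearComp T T) h).comp D₂.ker.subtypeL)) ∧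
      ∀ y, ‖Tn.symm y‖ ≤ (‖H₂‖ + Real.sqrt (γ₁ * C₂ / (γ₀ * mP)) + (γ₀ * mP)⁻¹) * ‖y‖ :=
  ChartLetterTestSection.exists_augHessian_equiv_of_testSection (Q := Q.bilinearComp T T) (D := D₂) H₂ hH₂
    (HardStepMonotone.bilinearComp_symm Q T hQsymm) (HardStepMonotone.transported_nonneg_of_dominates Q P T hγ₀.le hlo hP0)
    (mul_pos hγ₀ hmP) (nextFloor_of_sandwich Q P D T H hT hH hHorth hPsymm hP0 hγ₀.le hlo D₂ hcoP) (mul_nonneg hγ₁ hC₂0)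
    (nextEnergy_of_sandwich Q P D T H hT hH hTorth hQsymm hQ0 hγ₁ hhi H₂ hC₂)

/-- **THE SAME IN `ℝ≥0` CURRENCY** — HSCR ∕ HSIS's `hN` at scale `k+1` VERBATIM for any `N : ℝ≥0` with
`‖H₂‖ + √(γ₁C₂∕(γ₀m_P)) + (γ₀m_P)⁻¹ ≤ N`. [folklore] -/
theorem nextChart_of_sandwich_nnreal [CompleteSpace F] (Q P : E →L[ℝ] E →L[ℝ] ℝ) (D : E →L[ℝ] F) (T H : F →L[ℝ] E)
    (hT : ∀ k, D (T k) = k) (hH : ∀ k, D (H k) = k) (hTorth : ∀ k κ, D κ = 0 → Q (T k) κ = 0)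
    (hHorth : ∀ k κ, D κ = 0 → P (H k) κ = 0) (hQsymm : ∀ u v, Q u v = Q v u) (hPsymm : ∀ u v, P u v = P v u)
    (hQ0 : ∀ v, 0 ≤ Q v v) (hP0 : ∀ v, 0 ≤ P v v)
    {γ₀ γ₁ : ℝ} (hγ₀ : 0 < γ₀) (hγ₁ : 0 ≤ γ₁) (hlo : ∀ v, γ₀ * P v v ≤ Q v v) (hhi : ∀ v, Q v v ≤ γ₁ * P v v)
    (D₂ : F →L[ℝ] G) (H₂ : G →L[ℝ] F) (hH₂ : ∀ g, D₂ (H₂ g) = g)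
    {mP : ℝ} (hmP : 0 < mP) (hcoP : ∀ k, D₂ k = 0 → mP * ‖k‖ ^ 2 ≤ (P.bilinearComp H H) k k)
    {C₂ : ℝ} (hC₂0 : 0 ≤ C₂) (hC₂ : ∀ g, (P.bilinearComp H H) (H₂ g) (H₂ g) ≤ C₂ * ‖g‖ ^ 2)
    {N : ℝ≥0} (hN : ‖H₂‖ + Real.sqrt (γ₁ * C₂ / (γ₀ * mP)) + (γ₀ * mP)⁻¹ ≤ (N : ℝ)) :
    ∃ Tn : F ≃L[ℝ] G × (D₂.ker →L[ℝ] ℝ),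
      (∀ h, Tn h = (D₂ h, ((Q.bilinearComp T T) h).comp D₂.ker.subtypeL)) ∧ ∀ y, ‖Tn.symm y‖ ≤ N * ‖y‖ := by
  obtain ⟨Tn, hTn, hb⟩ := nextChart_of_sandwich Q P D T H hT hH hTorth hHorth hQsymm hPsymm hQ0 hP0 hγ₀ hγ₁ hlo hhi D₂ H₂ hH₂
    hmP hcoP hC₂0 hC₂
  exact ⟨Tn, hTn, fun y => (hb y).trans (mul_le_mul_of_nonneg_right hN (norm_nonneg y))⟩

/-! ## §3. The conjunction: HSIS's three next-scale inputs from reference letters -/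

/-- **THE NEXT STEP STARTS FROM REFERENCE LETTERS.**  Under §2's hypotheses plus the reference ceiling `P⁺ k k ≤ C_P‖k‖²` (`0 ≤ C_P`):
(i) `Q⁺` is `(γ₀m_P)`-coercive on `ker D₂`; (ii) `‖Q⁺‖ ≤ γ₁·C_P`; (iii) an equivalence `T⁺` reading `(D₂, Q⁺)` with
`‖(T⁺)⁻¹ y‖ ≤ (‖H₂‖ + √(γ₁C₂∕(γ₀m_P)) + (γ₀m_P)⁻¹)‖y‖` — `…HardStepInductiveStep.nextChart_of_letters`' inputs `hco`, `hβ`, and the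
equivalence itself, every number a letter of the reference form's hard steps times `γ₀` ∕ `γ₁`. [folklore] -/
theorem nextLetters_of_sandwich [CompleteSpace F] (Q P : E →L[ℝ] E →L[ℝ] ℝ) (D : E →L[ℝ] F) (T H : F →L[ℝ] E)
    (hT : ∀ k, D (T k) = k) (hH : ∀ k, D (H k) = k) (hTorth : ∀ k κ, D κ = 0 → Q (T k) κ = 0)
    (hHorth : ∀ k κ, D κ = 0 → P (H k) κ = 0) (hQsymm : ∀ u v, Q u v = Q v u) (hPsymm : ∀ u v, P u v = P v u)
    (hQ0 : ∀ v, 0 ≤ Q v v) (hP0 : ∀ v, 0 ≤ P v v)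
    {γ₀ γ₁ : ℝ} (hγ₀ : 0 < γ₀) (hγ₁ : 0 ≤ γ₁) (hlo : ∀ v, γ₀ * P v v ≤ Q v v) (hhi : ∀ v, Q v v ≤ γ₁ * P v v)
    {CP : ℝ} (hCP0 : 0 ≤ CP) (hCP : ∀ k, (P.bilinearComp H H) k k ≤ CP * ‖k‖ ^ 2)
    (D₂ : F →L[ℝ] G) (H₂ : G →L[ℝ] F) (hH₂ : ∀ g, D₂ (H₂ g) = g)
    {mP : ℝ} (hmP : 0 < mP) (hcoP : ∀ k, D₂ k = 0 → mP * ‖k‖ ^ 2 ≤ (P.bilinearComp H H) k k)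
    {C₂ : ℝ} (hC₂0 : 0 ≤ C₂) (hC₂ : ∀ g, (P.bilinearComp H H) (H₂ g) (H₂ g) ≤ C₂ * ‖g‖ ^ 2) :
    (∀ k, D₂ k = 0 → γ₀ * mP * ‖k‖ ^ 2 ≤ (Q.bilinearComp T T) k k) ∧
      ‖Q.bilinearComp T T‖ ≤ γ₁ * CP ∧
      ∃ Tn : F ≃L[ℝ] G × (D₂.ker →L[ℝ] ℝ),
        (∀ h, Tn h = (D₂ h, ((Q.bilinearComp T T) h).comp D₂.ker.subtypeL)) ∧
        ∀ y, ‖Tn.symm y‖ ≤ (‖H₂‖ + Real.sqrt (γ₁ * C₂ / (γ₀ * mP)) + (γ₀ * mP)⁻¹) * ‖y‖ :=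
  ⟨nextFloor_of_sandwich Q P D T H hT hH hHorth hPsymm hP0 hγ₀.le hlo D₂ hcoP,
    nextSize_of_sandwich Q P D T H hT hH hTorth hQsymm hQ0 hP0 hγ₀.le hγ₁ hlo hhi hCP0 hCP,
    nextChart_of_sandwich Q P D T H hT hH hTorth hHorth hQsymm hPsymm hQ0 hP0 hγ₀ hγ₁ hlo hhi D₂ H₂ hH₂ hmP hcoP hC₂0 hC₂⟩

/-! ## §4. In the reference's ENERGY currency the constants are the sandwich's and nothing else -/

/-- **THE ENERGY CURRENCY.**  If `E`'s inner product IS the reference form (`P u v = ⟪u, v⟫`), `F` carries the quotient (energy) norm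
(`H` the orthogonal section of `D`: `⟪Hk, κ⟫ = 0` on `ker D` and `‖Hk‖ = ‖k‖`) and so does `G` at the next blocking (`‖H₂g‖ = ‖g‖` for a
section `H₂` of `D₂`), then for `Q` symmetric with `γ₀‖v‖² ≤ Q v v ≤ γ₁‖v‖²` (`0 < γ₀`) and `T` its critical section: (i) `Q⁺` is
`γ₀`-coercive on ALL of `F`, (ii) `‖Q⁺‖ ≤ γ₁`, (iii) `∃ T⁺` reading `(D₂, Q⁺)` with `‖(T⁺)⁻¹ y‖ ≤ (1 + √(γ₁∕γ₀) + γ₀⁻¹)‖y‖` — the next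
letters ARE the sandwich constants: `k`-free, `L`-free, `d`-free (§3 with `m_P = C_P = C₂ = 1`, `‖H₂‖ ≤ 1`).  The sandwich itself is
inherited in this currency (`γ₀‖k‖² ≤ Q⁺ k k ≤ γ₁‖k‖²` on `F`), so the region is invariant along the tower. [folklore] -/
theorem nextLetters_energyCurrency [CompleteSpace F] (Q P : E →L[ℝ] E →L[ℝ] ℝ) (hP : ∀ u v, P u v = inner ℝ u v)
    (D : E →L[ℝ] F) (T H : F →L[ℝ] E) (hT : ∀ k, D (T k) = k) (hH : ∀ k, D (H k) = k)
    (hTorth : ∀ k κ, D κ = 0 → Q (T k) κ = 0) (hHorth : ∀ k κ, D κ = 0 → inner ℝ (H k) κ = 0) (hHiso : ∀ k, ‖H k‖ = ‖k‖)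
    (hQsymm : ∀ u v, Q u v = Q v u) {γ₀ γ₁ : ℝ} (hγ₀ : 0 < γ₀) (hγ₁ : 0 ≤ γ₁)
    (hlo : ∀ v, γ₀ * ‖v‖ ^ 2 ≤ Q v v) (hhi : ∀ v, Q v v ≤ γ₁ * ‖v‖ ^ 2)
    (D₂ : F →L[ℝ] G) (H₂ : G →L[ℝ] F) (hH₂ : ∀ g, D₂ (H₂ g) = g) (hH₂iso : ∀ g, ‖H₂ g‖ = ‖g‖) :
    (∀ k, γ₀ * ‖k‖ ^ 2 ≤ (Q.bilinearComp T T) k k) ∧ (∀ k, (Q.bilinearComp T T) k k ≤ γ₁ * ‖k‖ ^ 2) ∧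
      ‖Q.bilinearComp T T‖ ≤ γ₁ ∧
      ∃ Tn : F ≃L[ℝ] G × (D₂.ker →L[ℝ] ℝ),
        (∀ h, Tn h = (D₂ h, ((Q.bilinearComp T T) h).comp D₂.ker.subtypeL)) ∧
        ∀ y, ‖Tn.symm y‖ ≤ (1 + Real.sqrt (γ₁ / γ₀) + γ₀⁻¹) * ‖y‖ := by
  -- the reference letters in this currency: `P v v = ‖v‖²`, `P⁺ k k = ‖k‖²`, `P⁺(H₂g)(H₂g) = ‖g‖²`
  have hPsymm : ∀ u v, P u v = P v u := fun u v => by rw [hP, hP, real_inner_comm]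
  have hPsq : ∀ v, P v v = ‖v‖ ^ 2 := fun v => by rw [hP, real_inner_self_eq_norm_sq]
  have hP0 : ∀ v, 0 ≤ P v v := fun v => by rw [hPsq]; positivity
  have hHorth' : ∀ k κ, D κ = 0 → P (H k) κ = 0 := fun k κ hκ => by rw [hP]; exact hHorth k κ hκ
  have hPplus : ∀ k, (P.bilinearComp H H) k k = ‖k‖ ^ 2 := fun k => by
    rw [ContinuousLinearMap.bilinearComp_apply, hPsq, hHiso]
  have hlo' : ∀ v, γ₀ * P v v ≤ Q v v := fun v => by rw [hPsq]; exact hlo v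
  have hhi' : ∀ v, Q v v ≤ γ₁ * P v v := fun v => by rw [hPsq]; exact hhi v
  have hQ0 : ∀ v, 0 ≤ Q v v := fun v => (mul_nonneg hγ₀.le (by positivity)).trans (hlo v)
  have hcoP : ∀ k, D₂ k = 0 → (1 : ℝ) * ‖k‖ ^ 2 ≤ (P.bilinearComp H H) k k := fun k _ => by rw [hPplus, one_mul]
  have hCP : ∀ k, (P.bilinearComp H H) k k ≤ 1 * ‖k‖ ^ 2 := fun k => by rw [hPplus, one_mul]
  have hC₂ : ∀ g, (P.bilinearComp H H) (H₂ g) (H₂ g) ≤ 1 * ‖g‖ ^ 2 := fun g => by rw [hPplus, hH₂iso, one_mul]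
  obtain ⟨hfl, hsz, Tn, hTn, hb⟩ := nextLetters_of_sandwich Q P D T H hT hH hTorth hHorth' hQsymm hPsymm hQ0 hP0 hγ₀ hγ₁ hlo' hhi'
    zero_le_one hCP D₂ H₂ hH₂ one_pos hcoP zero_le_one hC₂
  have hH₂n : ‖H₂‖ ≤ 1 := ContinuousLinearMap.opNorm_le_bound _ zero_le_one fun g => by rw [hH₂iso, one_mul]
  refine ⟨fun k => ?_, fun k => ?_, by simpa using hsz, Tn, hTn, fun y => (hb y).trans ?_⟩
  · -- floor on all of F: HSMO along the section T with the reference floor 1 everywhere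
    have h := HardStepMonotone.coercive_of_dominates_reference Q P D T H hT hH hHorth' hPsymm (fun κ _ => hP0 κ) hγ₀.le hlo'
      (mP := 1) (fun k => by rw [hPplus, one_mul]) k
    simpa using h
  · have h := HardStepMonotone.quad_le_of_dominated_reference Q P D T H hT hH hTorth hQsymm (fun κ _ => hQ0 κ) hγ₁ hhi' hCP k
    simpa using h
  · have e1 : γ₁ * 1 / (γ₀ * 1) = γ₁ / γ₀ := by rw [mul_one, mul_one]
    have e2 : (γ₀ * 1)⁻¹ = γ₀⁻¹ := by rw [mul_one]
    rw [e1, e2]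
    have hs : 0 ≤ Real.sqrt (γ₁ / γ₀) := Real.sqrt_nonneg _
    have hg : 0 ≤ γ₀⁻¹ := (inv_pos.mpr hγ₀).le
    have : ‖H₂‖ + Real.sqrt (γ₁ / γ₀) + γ₀⁻¹ ≤ 1 + Real.sqrt (γ₁ / γ₀) + γ₀⁻¹ := by linarith
    exact mul_le_mul_of_nonneg_right this (norm_nonneg y)

/-! ## §5. Toy -/

/-- Toy (real arithmetic of the chart constant: with `‖H₂‖ = 1`, `γ₀ = γ₁ = 1`, `C₂ = m_P = 1` the constant is `1 + √1 + 1 = 3`). -/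
example : (1 : ℝ) + Real.sqrt (1 * 1 / (1 * 1)) + (1 * 1 : ℝ)⁻¹ = 3 := by norm_num

end Summit.QuantumFields.BalabanUV.T4Continuum.NE7b.HardStepReferenceLetters

end
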